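import Summits.Parity.GeneralizedHardyLittlewood.Theorems.LeeYangFibresModelHyperbolicityDefs
import Literature.NumberTheory.Sieve.RoughOmegaCellsAsymptotic
import Literature.NumberTheory.LFunctions.PrimeSumStandardWeights
import Literature.NumberTheory.LFunctions.MidpointSieveGain
import Mathlib.Analysis.Complex.ExponentialBounds
import HarnessLib

/-!
# Stub `stub_cellRate` of line `window-chain-transport` for crux `LeeYangFibres.ModelHyperbolicity`
# (stmt-Parity-14110): Alladi's cell asymptotics with a rate

`DensityCalculus → CellRate`: the registered stub, obtained by instantiating the abstract Literature
theorem `Literature.NumberTheory.Sieve.exists_abs_cell_sub_main_le` (Alladi's asymptotic for the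
Ω-cells of the rough integers, with a rate, for any density family satisfying the Alladi–Buchstab
recursion) with `F := cellDensity` — the calculus hypothesis supplies continuity (C1), vanishing (C2)
and the FTC derivative (C4), the recursion is the definition of `cellDensity`, `F_0 = 1` is
`cellDensity_zero` — together with the prime number theorem in `(X, Y)`-format
(a PRIVATE copy `rate3_exists_abs_card_primes_Icc_ceil_floor_sub_le` of the landed
`Literature/NumberTheory/LFunctions/PrimesIntervalMainTerm.lean`, p74237 — landed but not yet built on the Lean farm
when this file was prepared; the copy is verbatim, `rate3_`-prefixed and private) and the bridge
`omegaCell N X (j+1) = #{b ∈ roughIcc N X : Ω(b) = j+1}`.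
-/

noncomputable section

namespace Summit.Parity.GeneralizedHardyLittlewood.Cruxes.ModelHyperbolicity.WindowChainTransport

open scoped BigOperators
open Filter Literature.NumberTheory.Sieve

section PrimesCopy
open Finset Real Literature.NumberTheory.LFunctions
open scoped Chebyshev

/-! ### Private copy of `LFunctions/PrimesIntervalMainTerm.lean` (landed p74237, awaiting farm build) -/


/-! ### Trivial bounds -/

/-- `#{⌈y⌉ ≤ p ≤ ⌊x⌋} ≤ x` for `0 ≤ x` (primes are `≥ 1`, so the set lies in `[1, ⌊x⌋]`).
[folklore] -/
private theorem rate3_card_primes_Icc_ceil_floor_le {x y : ℝ} (hx : 0 ≤ x) :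
    (((Finset.Icc ⌈y⌉₊ ⌊x⌋₊).filter Nat.Prime).card : ℝ) ≤ x := by
  have h1 : ((Finset.Icc ⌈y⌉₊ ⌊x⌋₊).filter Nat.Prime).card ≤ ⌊x⌋₊ := by
    calc ((Finset.Icc ⌈y⌉₊ ⌊x⌋₊).filter Nat.Prime).card ≤ (Finset.Icc 1 ⌊x⌋₊).card := by
          refine Finset.card_le_card fun p hp => ?_
          simp only [Finset.mem_filter, Finset.mem_Icc] at hp ⊢
          exact ⟨hp.2.one_lt.le, hp.1.2⟩
      _ = ⌊x⌋₊ := by simp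
  calc (((Finset.Icc ⌈y⌉₊ ⌊x⌋₊).filter Nat.Prime).card : ℝ) ≤ ⌊x⌋₊ := by exact_mod_cast h1
    _ ≤ x := Nat.floor_le hx

/-- **The trivial bound** `|#{⌈y⌉ ≤ p ≤ ⌊x⌋} − (x/log x − y/log y)| ≤ 4x` for `2 ≤ y ≤ x`
(`0 ≤ #{…} ≤ x` and `0 ≤ t/log t ≤ 3t/2` for `t ≥ 2`, as `log 2 > 2/3`). [folklore] -/
private theorem rate3_abs_card_primes_Icc_ceil_floor_sub_le_four_mul {x y : ℝ} (hy : 2 ≤ y) (hyx : y ≤ x) :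
    |(((Finset.Icc ⌈y⌉₊ ⌊x⌋₊).filter Nat.Prime).card : ℝ) - (x / Real.log x - y / Real.log y)| ≤
      4 * x := by
  have hx0 : 0 ≤ x := by linarith
  have hy0 : 0 ≤ y := by linarith
  have hl2 : (2 : ℝ) / 3 < Real.log 2 := by have := Real.log_two_gt_d9; linarith
  have hly : Real.log 2 ≤ Real.log y := Real.log_le_log two_pos hy
  have hlx : Real.log y ≤ Real.log x := Real.log_le_log (by linarith) hyx
  have hly0 : 0 < Real.log y := by linarith
  have hlx0 : 0 < Real.log x := by linarith
  have hP := rate3_card_primes_Icc_ceil_floor_le (y := y) hx0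
  have hP0 : (0 : ℝ) ≤ (((Finset.Icc ⌈y⌉₊ ⌊x⌋₊).filter Nat.Prime).card : ℝ) := Nat.cast_nonneg _
  have h1 : 0 ≤ x / Real.log x := by positivity
  have h2 : x / Real.log x ≤ 3 / 2 * x := by
    rw [div_le_iff₀ hlx0]
    have : x * (2 / 3) ≤ x * Real.log x := mul_le_mul_of_nonneg_left (by linarith) hx0
    linarith
  have h3 : 0 ≤ y / Real.log y := by positivity
  have h4 : y / Real.log y ≤ 3 / 2 * x := by
    rw [div_le_iff₀ hly0]
    have : y * (2 / 3) ≤ y * Real.log y := mul_le_mul_of_nonneg_left (by linarith) hy0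
    nlinarith
  rw [abs_le]
  constructor <;> linarith

/-- For `2 ≤ y < e²` (`y ≤ x`): `|#{⌈y⌉ ≤ p ≤ ⌊x⌋} − (x/log x − y/log y)| ≤ 16 x/log² y`
(the trivial bound and `log y < 2`). [folklore] -/
private theorem rate3_abs_card_primes_Icc_ceil_floor_sub_le_of_lt_exp_two {x y : ℝ} (hy : 2 ≤ y) (hyx : y ≤ x)
    (hy2 : y < Real.exp 2) :
    |(((Finset.Icc ⌈y⌉₊ ⌊x⌋₊).filter Nat.Prime).card : ℝ) - (x / Real.log x - y / Real.log y)| ≤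
      16 * x / Real.log y ^ 2 := by
  have hx0 : 0 ≤ x := by linarith
  have hy0 : 0 < y := by linarith
  have hly0 : 0 < Real.log y := Real.log_pos (by linarith)
  have hly2 : Real.log y < 2 := by rw [Real.log_lt_iff_lt_exp hy0]; exact hy2
  refine (rate3_abs_card_primes_Icc_ceil_floor_sub_le_four_mul hy hyx).trans ?_
  rw [le_div_iff₀ (by positivity)]
  have : Real.log y ^ 2 ≤ 4 := by nlinarith
  nlinarith

/-! ### The main estimate -/

/-- **Primes in `[y, x]` against `x/log x − y/log y`, for all `2 ≤ y ≤ x`.** If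
`|ϑ(t) − t| ≤ C₀ t/log² t` for all `t ≥ 2` (`C₀ ≥ 0`), then
`|#{p prime : ⌈y⌉ ≤ p ≤ ⌊x⌋} − (x/log x − y/log y)| ≤ (20 + 12 C₀) x/log² y`.
For `y ≥ e²`: `a = ⌈y⌉ − 1 ≥ e`, `{⌈y⌉ ≤ p ≤ ⌊x⌋} = {⌊a⌋ < p ≤ ⌊x⌋}`,
`#{⌊a⌋ < p ≤ ⌊x⌋} = x/log x − a/log a + O((1 + 3C₀) x/log² a)` (`abs_card_primes_Ioc_sub_le`),
`0 ≤ y/log y − a/log a ≤ 1 ≤ 4x/log² y` and `log² y ≤ 4 log² a`; `y < e²` is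
`rate3_abs_card_primes_Icc_ceil_floor_sub_le_of_lt_exp_two` (the prime number theorem with the
de la Vallée Poussin error term, integrated by parts; the `u ≤ 2` base case of the rough-number
asymptotics). [cite: Lichtman2025LinearSieve, Lemma 6.1] -/
private theorem rate3_abs_card_primes_Icc_ceil_floor_sub_le {C₀ : ℝ} (hC₀ : 0 ≤ C₀)
    (hE : ∀ t : ℝ, 2 ≤ t → |θ t - t| ≤ C₀ * t / Real.log t ^ 2) {x y : ℝ} (hy : 2 ≤ y)
    (hyx : y ≤ x) :
    |(((Finset.Icc ⌈y⌉₊ ⌊x⌋₊).filter Nat.Prime).card : ℝ) - (x / Real.log x - y / Real.log y)| ≤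
      (20 + 12 * C₀) * x / Real.log y ^ 2 := by
  have hx0 : 0 < x := by linarith
  rcases lt_or_ge y (Real.exp 2) with hy2 | hy2
  · refine (rate3_abs_card_primes_Icc_ceil_floor_sub_le_of_lt_exp_two hy hyx hy2).trans ?_
    rw [div_le_div_iff_of_pos_right
      (by have := Real.log_pos (by linarith : (1 : ℝ) < y); positivity)]
    nlinarith
  -- `y ≥ e²`
  have he1 : (2 : ℝ) ≤ Real.exp 1 := by have := Real.add_one_le_exp (1 : ℝ); linarith
  have he2 : Real.exp 1 ≤ Real.exp 2 - 1 := by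
    have h2 : Real.exp 2 = Real.exp 1 * Real.exp 1 := by rw [← Real.exp_add]; norm_num
    nlinarith
  have hy0 : 0 < y := by linarith
  have hy3 : 3 ≤ y := le_trans (by have := Real.add_one_le_exp (2 : ℝ); linarith) hy2
  have hy1 : 1 < y := by linarith
  have hly : 0 < Real.log y := Real.log_pos hy1
  -- `N = ⌈y⌉`, `a = N − 1`
  set N := ⌈y⌉₊ with hN
  have hN1 : 0 < N := Nat.ceil_pos.mpr hy0
  set a : ℝ := ((N - 1 : ℕ) : ℝ) with ha_def
  have haN : a = (N : ℝ) - 1 := by rw [ha_def, Nat.cast_sub hN1, Nat.cast_one]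
  have hyN : y ≤ N := Nat.le_ceil y
  have hNy : (N : ℝ) < y + 1 := Nat.ceil_lt_add_one hy0.le
  have hay : a ≤ y := by rw [haN]; linarith
  have hya : y ≤ a + 1 := by rw [haN]; linarith
  have hea : Real.exp 1 ≤ a := by linarith
  have ha0 : 0 < a := (Real.exp_pos 1).trans_le hea
  have hla : 1 ≤ Real.log a := by rw [Real.le_log_iff_exp_le ha0]; exact hea
  have hlay : Real.log a ≤ Real.log y := Real.log_le_log ha0 hay
  have hax : a ≤ x := hay.trans hyx
  have hasq : y ≤ a ^ 2 := by
    have h1 : y - 1 ≤ a := by linarith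
    have h2 : (y - 1) ^ 2 ≤ a ^ 2 := pow_le_pow_left₀ (by linarith) h1 2
    have h3 : y ≤ (y - 1) ^ 2 := by nlinarith
    exact h3.trans h2
  have hlya : Real.log y ≤ 2 * Real.log a := by
    calc Real.log y ≤ Real.log (a ^ 2) := Real.log_le_log hy0 hasq
      _ = 2 * Real.log a := by rw [Real.log_pow]; norm_num
  -- `{⌈y⌉ ≤ p ≤ ⌊x⌋} = {⌊a⌋ < p ≤ ⌊x⌋}`
  have hfloor_a : ⌊a⌋₊ = N - 1 := by rw [ha_def, Nat.floor_natCast]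
  have hPeq : (Finset.Icc N ⌊x⌋₊).filter Nat.Prime = (Finset.Ioc ⌊a⌋₊ ⌊x⌋₊).filter Nat.Prime := by
    rw [hfloor_a]
    congr 1
    ext p
    simp only [Finset.mem_Icc, Finset.mem_Ioc]
    omega
  rw [hPeq]
  -- `#{⌊a⌋ < p ≤ ⌊x⌋} = x/log x − a/log a + O(x/log² a)`
  have hprimes := abs_card_primes_Ioc_sub_le hea hax hC₀ hE
  -- `0 ≤ y/log y − a/log a ≤ 1`
  have hmono : a / Real.log a ≤ y / Real.log y := by
    have h := Real.log_div_self_antitoneOn hea (hea.trans hay) hay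
    -- `h : log y / y ≤ log a / a`
    rw [div_le_div_iff₀ (by linarith) hly]
    have h' := (div_le_div_iff₀ hy0 ha0).mp h
    linarith
  have hdiff : y / Real.log y - a / Real.log a ≤ 1 := by
    have h1 : y / Real.log y ≤ y / Real.log a :=
      div_le_div_of_nonneg_left hy0.le (by linarith) hlay
    have h2 : y / Real.log a - a / Real.log a ≤ 1 := by
      rw [← sub_div, div_le_one (by linarith)]; linarith
    linarith
  -- `log² y ≤ 4x` and `x/log² a ≤ 4 x/log² y`
  have hlogsq : Real.log y ^ 2 ≤ 4 * x := by
    have hs0 : 0 < Real.sqrt y := Real.sqrt_pos.mpr hy0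
    have h1 : Real.log (Real.sqrt y) ≤ Real.sqrt y - 1 := Real.log_le_sub_one_of_pos hs0
    have h2 : Real.log y = 2 * Real.log (Real.sqrt y) := by rw [Real.log_sqrt hy0.le]; ring
    have h4 : Real.log y ≤ 2 * Real.sqrt y := by linarith
    calc Real.log y ^ 2 ≤ (2 * Real.sqrt y) ^ 2 := pow_le_pow_left₀ hly.le h4 2
      _ = 4 * y := by rw [mul_pow, Real.sq_sqrt hy0.le]; norm_num
      _ ≤ 4 * x := by linarith
  have hratio : x / Real.log a ^ 2 ≤ 4 * (x / Real.log y ^ 2) := by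
    rw [div_le_iff₀ (by positivity)]
    calc x = x / Real.log y ^ 2 * Real.log y ^ 2 := by field_simp
      _ ≤ x / Real.log y ^ 2 * (2 * Real.log a) ^ 2 := by gcongr
      _ = 4 * (x / Real.log y ^ 2) * Real.log a ^ 2 := by ring
  have hU0 : 0 ≤ x / Real.log y ^ 2 := by positivity
  have h1U : (1 : ℝ) ≤ 4 * (x / Real.log y ^ 2) := by
    rw [mul_div_assoc', le_div_iff₀ (by positivity)]; linarith
  -- assembly
  have hkey : |(((Finset.Ioc ⌊a⌋₊ ⌊x⌋₊).filter Nat.Prime).card : ℝ) -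
      (x / Real.log x - y / Real.log y)| ≤ 1 + (1 + 3 * C₀) * x / Real.log a ^ 2 := by
    have h := abs_le.mp hprimes
    rw [abs_le]
    constructor <;> linarith [h.1, h.2]
  calc _ ≤ 1 + (1 + 3 * C₀) * x / Real.log a ^ 2 := hkey
    _ = 1 + (1 + 3 * C₀) * (x / Real.log a ^ 2) := by ring
    _ ≤ 4 * (x / Real.log y ^ 2) + (1 + 3 * C₀) * (4 * (x / Real.log y ^ 2)) := by gcongr
    _ = (8 + 12 * C₀) * (x / Real.log y ^ 2) := by ring
    _ ≤ (20 + 12 * C₀) * (x / Real.log y ^ 2) := by gcongr; norm_num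
    _ = (20 + 12 * C₀) * x / Real.log y ^ 2 := mul_div_assoc' _ _ _

/-- **Primes in `[y, x]`, packaged**: there is `C ≥ 0` such that for all real `2 ≤ y ≤ x`,
`|#{p prime : ⌈y⌉ ≤ p ≤ ⌊x⌋} − (x/log x − y/log y)| ≤ C x/log² y`
(`rate3_abs_card_primes_Icc_ceil_floor_sub_le` with the constant of
`exists_abs_theta_sub_self_le_div_log_sq`, the prime number theorem with the de la Vallée Poussin
error term — PROVED in the tree; the `u ≤ 2` base case of the rough-number asymptotics, valid here
for all `x ≥ y`). [cite: Lichtman2025LinearSieve, Lemma 6.1] -/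
private theorem rate3_exists_abs_card_primes_Icc_ceil_floor_sub_le :
    ∃ C : ℝ, 0 ≤ C ∧ ∀ x y : ℝ, 2 ≤ y → y ≤ x →
      |(((Finset.Icc ⌈y⌉₊ ⌊x⌋₊).filter Nat.Prime).card : ℝ) - (x / Real.log x - y / Real.log y)| ≤
        C * x / Real.log y ^ 2 := by
  obtain ⟨C₀, hC₀, hE⟩ := exists_abs_theta_sub_self_le_div_log_sq
  exact ⟨20 + 12 * C₀, by positivity, fun x y hy hyx =>
    rate3_abs_card_primes_Icc_ceil_floor_sub_le hC₀ hE hy hyx⟩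


end PrimesCopy

/-! ### The bridge and the stub -/

/-- The Ω-cells with an integer threshold are the `Ω`-split of the tree's `roughIcc`:
`omegaCell N X (j+1) = #{b ∈ roughIcc N X : Ω(b) = j+1}` (for `b ≥ 2`, "every prime factor is `≥ N`"
iff "`N ≤ P⁻(b)`"; `b = 1` has `Ω = 0`). -/
theorem omegaCell_succ_eq_card_filter (N X j : ℕ) :
    omegaCell N X (j + 1) =
      ((roughIcc N X).filter (fun b => ArithmeticFunction.cardFactors b = j + 1)).card := by
  unfold omegaCell roughIcc
  rw [Finset.filter_filter]
  congr 1
  refine Finset.filter_congr fun b hb => ?_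
  rw [Finset.mem_Icc] at hb
  constructor
  · rintro ⟨hN, hΩ⟩
    refine ⟨fun p hp => ?_, hΩ⟩
    have hpp := Nat.prime_of_mem_primeFactors hp
    have hpb := Nat.dvd_of_mem_primeFactors hp
    exact hN.trans (Nat.minFac_le_of_dvd hpp.two_le hpb)
  · rintro ⟨hall, hΩ⟩
    refine ⟨?_, hΩ⟩
    have hb1 : b ≠ 1 := by
      rintro rfl
      simp at hΩ
    have hmf : b.minFac.Prime := Nat.minFac_prime hb1
    exact hall _ (Nat.mem_primeFactors.mpr ⟨hmf, Nat.minFac_dvd b, by omega⟩)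

/-- **Stub `stub_cellRate` (registered): Alladi's cell asymptotics with a rate, `DensityCalculus → CellRate`.**
Instantiate `exists_abs_cell_sub_main_le` with `F := cellDensity`: (C1) gives continuity on `[1, ∞)`,
(C2) the vanishing `I_{i+2}(v) = 0` for `v ≤ i+2`, (C4) the derivative `I_{i+2}'(s) = I_{i+1}(s−1)/(s−1)`
(`s > 2`), the recursion `I_{i+2}(v) = ∫_1^{v−1} I_{i+1}(s) ds/s` (`v ≥ 2`) is the definition
(`max (v−1) 1 = v−1`), `I_1 = 1` is `cellDensity_zero`; the prime number theorem enters through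
`exists_abs_card_primes_Icc_ceil_floor_sub_le`. -/
theorem stub_cellRate : DensityCalculus → CellRate := by
  intro hC j k
  obtain ⟨hC1, hC2, -, hC4, -, -, -⟩ := hC
  have hF0 : ∀ s : ℝ, cellDensity 0 s = 1 := cellDensity_zero
  have hFc : ∀ i, ContinuousOn (cellDensity i) (Set.Ici 1) := fun i => (hC1 i).continuousOn
  have hFrec : ∀ (i : ℕ) (v : ℝ), 2 ≤ v →
      cellDensity (i + 1) v = ∫ s in (1 : ℝ)..(v - 1), cellDensity i s / s := by
    intro i v hv
    rw [cellDensity, max_eq_left (by linarith)]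
  obtain ⟨Cp, hCp0, hCp⟩ := rate3_exists_abs_card_primes_Icc_ceil_floor_sub_le
  have hprime : ∀ k : ℕ, ∃ C : ℝ, 0 ≤ C ∧ ∀ X Y : ℝ, 2 ≤ Y → Y ≤ X →
      Real.log X ≤ k * Real.log Y →
      |((((Finset.Icc ⌈Y⌉₊ ⌊X⌋₊).filter Nat.Prime).card : ℕ) : ℝ) -
        (X / Real.log X - Y / Real.log Y)| ≤ C * X / Real.log Y ^ 2 :=
    fun _ => ⟨Cp, hCp0, fun X Y hY hYX _ => hCp X Y hY hYX⟩
  obtain ⟨C, -, h⟩ := exists_abs_cell_sub_main_le hF0 hFc hC2 hFrec hC4 hprime j k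
  refine ⟨C, fun X Y hY hYX hXY => ?_⟩
  rw [omegaCell_succ_eq_card_filter]
  exact h X Y hY hYX hXY

end Summit.Parity.GeneralizedHardyLittlewood.Cruxes.ModelHyperbolicity.WindowChainTransport

end
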